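/-
Copyright (c) 2026 the pub-hodgecm-mathlib formalisation cell (harness21).  Prover seat hodgecm-mathlib-LH7-p05 (g0), req620 Track A «(D-RAM) FOUR-FRAME» squad, helper lane on
h413 = stmt-HodgeConjecture-24833 (count-neutral).  β-BOARD row R8-EQ-b «H(ρ) ABOVE THE LOCUS ON THE EQUILATERAL KEY» (β chair F0P3a-p01 (g37) LEDGER #17), FILE EQ-2c.  2026-09-04.
-/
import Summits.HodgeConjecture.HodgeConjecture.Theorems.F0P3cDyRamLabelledOddCoreHangingRepClassSum    -- EQ-2b (this seat): HEAD `labelledOddCount_div_relIndex_coreHanging_rep_eq`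
import Summits.HodgeConjecture.HodgeConjecture.Theorems.F0P3cDyRamLabelledOddGluedDecomposition      -- ★ p861389 (this seat): `labelledOddCount_mapGL_diagGLUnits`
import Summits.HodgeConjecture.HodgeConjecture.Theorems.F0P3cDyRamLabelledOddGlueWindowCut           -- ★ ASM-1 (this seat): `v_eq_pow_iff_le_and_not_le`, `v_add_eq_pow_iff_of_v_sub_le`
import Summits.HodgeConjecture.HodgeConjecture.Theorems.F0P3cDyRamLabelledOddCoreHangingShell        -- ★ p861362 (LH7-p08 (g0)): `latticeInLevel_diag_latt_H_iff`
import Summits.HodgeConjecture.HodgeConjecture.Theorems.F0P3cDyRamDiagonalCoreHangingCount           -- ★ B7 (iv) (C): `finsum_stabiliserWeight_orbit_eq`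
import Summits.HodgeConjecture.HodgeConjecture.Theorems.F0P3cDyRamDiagonalStratumTools                -- ★: `unitStabilizer_mapGL_diagGLUnits`, `stabiliserWeight_mapGL_diagGLUnits`
import HarnessLib

/-!
# Crux `H413`, line LH4 «(D-RAM) FOUR-FRAME» — (β) table, β-BOARD row R8-EQ-b (THE EQUILATERAL KEY, `H(ρ)` ABOVE THE LOCUS), FILE EQ-2c:
# THE WINDOW CUT OF THE CORE-HANGING REPRESENTATIVE IN `g`-CURRENCY, AND ITS ORBIT SUM

Cell `hodgecm-mathlib` (D-0151), FLOOR 0, crux item H413 = `stmt-HodgeConjecture-24833`, route `HCCMUnconditional`; squad F0∕P3c∕LH4 (β-table fan; β chair F0P3a-p01 (g37), H-line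
junction LH4-p05 (g9)).  THEOREMS ONLY (no `def`, no instance, no notation, no `sorry`, default heartbeats); ★-only imports; lane `--supports stmt-HodgeConjecture-24833 --as helper`
(count-neutral); pays NO row, states NO law.  Consumer: this seat's FILE EQ-2d (the window assembly `finsum_stratum_H_shell_labelledOdd_div_relIndex_eq_zero_of_equilateral_window`).

THE MATHEMATICS (chair's read, LEDGER #17; the `t′ = 0` twins of ★ ASM-1 §2 and of the orbit step of ★ p861389).  Equilateral key `|α−1| = |β−1| = |β−α| = |ϖ|^m`, `g₀ = (β−1)∕(α−1)`;
the core-hanging class representative `latt(1 0 0; 1 ϖ^ρ 0; 1+g ϖ^ρ ϖ^{2ρ})`, `|g| = 1`; the WINDOW `m + 1 ≤ 2ρ + ℓ₀ =: m + E`, `2ρ + mc ≤ 2m` (so `1 ≤ E < ρ`, `ρ + ℓ₀ + 1 ≤ m`).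
* §1 `glue_and_shell_latt_coreHanging_rep_iff`: ★ p861362's read at `x = ζ = 1`, `y″ = g` has mixed letter `(β−1) + (α−1)g = (α−1)(g + g₀)`, so the `X`-level is `ℓ ⟺ ℓ + ρ ≤ m ∧
  |g + g₀| ≤ |ϖ|^{ℓ+2ρ−m}`; the square token is automatic on the cut (its mixed letter `(β−1)·MIX + (α−1)(α−β)g` has the distinct valuations `2m + E`, `2m`); hence
  `(|g + g₀| ≤ |ϖ|^{2ρ−m} ∧ shell) ⟺ |g + g₀| = |ϖ|^E`, and `…_of_near` moves the centre to any `c₀` with `|c₀ − g₀| ≤ |ϖ|^{E+1}`.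
* §2 `finsum_orbit_labelledOdd_div_relIndex_coreHanging_rep_eq`: along the unit-torus orbit of the representative the summand `lOC_i ∕ [𝒰 : N]` is constant (★ p861389 §3, ★ StratumTools),
  EQ-2b's HEAD writes it as `(ω(D_i) ∕ (2·#Aβ·#Aγ)·ΣΣ) · w(M)`, and ★ B7 (iv)(C) `finsum_stabiliserWeight_orbit_eq` sums the weight: the orbit carries `mass · ω(D_i)∕(2·#Aβ·#Aγ)·ΣΣ`.
HONEST LABEL: count-neutral; R8-EQ ∕ hH ∕ hRest ∕ (β-BAL) ∕ (β) ∕ T₊ OPEN; `HC_CM` is proved only modulo the 7 printed citations (2 remaining named inputs: hLiu418 =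
`stmt-HodgeConjecture-24832`, h413 = `stmt-HodgeConjecture-24833`) until rung 0 closes.
References: [Kottwitz1986BaseChangeUnits] §1 pp. 240–241 · [Rogawski1990] §4.9 Prop. 4.9.1 (a)(b) p. 55 · [LanglandsShelstad1987] §3 · [Serre1980Trees] Ch. II §1.1.
-/

set_option autoImplicit false

noncomputable section

namespace Summit.HodgeConjecture.HodgeConjecture.Cruxes.H413.F0P3cDyRamLabelledOddCoreHangingWindowCut

open Matrix WithZero
open Literature.NumberTheory.Automorphic Literature.NumberTheory.Automorphic.HermitianLattice Literature.NumberTheory.Automorphic.UnitaryGroup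
open Literature.NumberTheory.Automorphic.UnitaryLatticeTree Literature.NumberTheory.Automorphic.UnitaryThreeFourFrame
open Literature.NumberTheory.LocalFields Literature.NumberTheory.LocalFields.WildQuadraticDatum
open Summit.HodgeConjecture.HodgeConjecture.Cruxes.H413.F0P3cDyRamFourFramePieces
open Summit.HodgeConjecture.HodgeConjecture.Cruxes.H413.F0P3cDyRamFourFrameCensusDefs
open Summit.HodgeConjecture.HodgeConjecture.Cruxes.H413.F0P3cDyRamStageOneBDefs (mcOfRecord)
open Summit.HodgeConjecture.HodgeConjecture.Cruxes.H413.F0P3cDyRamDiagonalTorusDefs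
open Summit.HodgeConjecture.HodgeConjecture.Cruxes.H413.F0P3cDyRamDiagonalStrataDefs
open Summit.HodgeConjecture.HodgeConjecture.Cruxes.H413.F0P3cDyRamLabelledOddCountDefs
open Summit.HodgeConjecture.HodgeConjecture.Cruxes.H413.F0P3cDyRamLabelledOddCoreHangingShell (latticeInLevel_diag_latt_H_iff)
open Summit.HodgeConjecture.HodgeConjecture.Cruxes.H413.F0P3cDyRamLabelledOddGlueWindowCut (v_eq_pow_iff_le_and_not_le v_add_eq_pow_iff_of_v_sub_le)
open Summit.HodgeConjecture.HodgeConjecture.Cruxes.H413.F0P3cDyRamLabelledOddGluedDecomposition (labelledOddCount_mapGL_diagGLUnits)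
open Summit.HodgeConjecture.HodgeConjecture.Cruxes.H413.F0P3cDyRamDiagonalStratumTools (unitStabilizer_mapGL_diagGLUnits stabiliserWeight_mapGL_diagGLUnits)
open Summit.HodgeConjecture.HodgeConjecture.Cruxes.H413.F0P3cDyRamDiagonalCoreHangingCount (finsum_stabiliserWeight_orbit_eq)
open Summit.HodgeConjecture.HodgeConjecture.Cruxes.H413.F0P3cDyRamValueClassLabelEquivariant (isTorusEquivariantLabel_valueClassLabel)
open Summit.HodgeConjecture.HodgeConjecture.Cruxes.H413.F0P3cDyRamLabelledOddCoreHangingRepClassSum (labelledOddCount_div_relIndex_coreHanging_rep_eq)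
open scoped Valued WithZero Matrix MatrixGroups

variable {K : Type} [Field K] [Valued K ℤᵐ⁰] {σ : K →+* K} {ϖ : K} {d t : ℕ} {α β : K} {N₀ n₁ n₂ n₃ : ℕ}

/-! ## §1  The window cut of the core-hanging representative in `g`-currency (equilateral key) -/

/-- **THE WINDOW CUT OF `latt V_H(1,1,g)`, CENTRE `g₀ = (β−1)∕(α−1)`** (equilateral key `n₁ = n₂ = n₃`, window `2ρ + ℓ₀ = n₂ + E`, `1 ≤ E`, `2ρ + mc ≤ 2n₂`; `|g| = 1`):
`(|g + g₀| ≤ |ϖ|^{2ρ−n₂} ∧ clean shell) ⟺ |g + g₀| = |ϖ|^E` (★ p861362's read at `x = ζ = 1`, `y″ = g`; the square token is automatic on the cut).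
[cite: Kottwitz1986BaseChangeUnits, §1 pp. 240–241] [cite: Serre1980Trees, Ch. II §1.1] -/
theorem glue_and_shell_latt_coreHanging_rep_iff (hD : IsRamifiedQuadraticDatum σ ϖ d t) (h2 : Valued.v (2 : K) < 1) (h2d : 2 ≤ d) (hE : IsElementDatum σ ϖ N₀ α β n₁ n₂ n₃)
    (ρ : ℕ) (h12 : n₁ = n₂) (h23 : n₂ = n₃) {E : ℕ} (hlo : 2 * ρ + d % 2 = n₂ + E) (hE1 : 1 ≤ E) (hhi : 2 * ρ + mcOfRecord d ≤ 2 * n₂)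
    {g : K} (hg : Valued.v g = 1) :
    (Valued.v (g + (β - 1) / (α - 1)) ≤ Valued.v ϖ ^ (2 * ρ - n₂) ∧
        (LatticeInLevel ϖ (d % 2) (Matrix.diagonal ![α - 1, β - 1, 0]) (latt (!![1, 0, 0; 1, ϖ ^ ρ, 0; 1 * 1 + g, ϖ ^ ρ * 1, ϖ ^ (2 * ρ)] : Matrix (Fin 3) (Fin 3) K)) ∧
          ¬ LatticeInLevel ϖ (d % 2 + 1) (Matrix.diagonal ![α - 1, β - 1, 0]) (latt (!![1, 0, 0; 1, ϖ ^ ρ, 0; 1 * 1 + g, ϖ ^ ρ * 1, ϖ ^ (2 * ρ)] : Matrix (Fin 3) (Fin 3) K)) ∧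
          LatticeInLevel ϖ (mcOfRecord d) (Matrix.diagonal ![(α - 1) * (α - 1), (β - 1) * (β - 1), 0])
            (latt (!![1, 0, 0; 1, ϖ ^ ρ, 0; 1 * 1 + g, ϖ ^ ρ * 1, ϖ ^ (2 * ρ)] : Matrix (Fin 3) (Fin 3) K)))) ↔
      Valued.v (g + (β - 1) / (α - 1)) = Valued.v ϖ ^ E := by
  classical
  obtain ⟨hσ, hvσ, hϖ, -, -, -, -⟩ := id hD
  have hϖ0 : ϖ ≠ 0 := fun h0 => by rw [h0, map_zero] at hϖ; exact WithZero.coe_ne_zero hϖ.symm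
  have hvϖ : Valued.v ϖ ≠ 0 := (Valuation.ne_zero_iff _).2 hϖ0
  have hpw : ∀ a b : ℕ, Valued.v ϖ ^ a ≤ Valued.v ϖ ^ b ↔ b ≤ a := fun a b => by
    rw [v_varpi_pow hϖ, v_varpi_pow hϖ, exp_le_exp]; omega
  have hpwlt : ∀ a b : ℕ, Valued.v ϖ ^ a < Valued.v ϖ ^ b ↔ b < a := fun a b => by
    rw [v_varpi_pow hϖ, v_varpi_pow hϖ, exp_lt_exp]; omega
  have hmc2 : 2 * (d % 2) + 2 ≤ mcOfRecord d ∧ mcOfRecord d ≤ 3 * d := by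
    simp only [mcOfRecord, F0P3cDyRamFourFramePieces.mstarOfRecord]; omega
  have hn₂ : N₀ ≤ n₂ := hE.2.2.2.2.2.2.2.2.2.1
  have hρℓ : d % 2 + 1 + ρ ≤ n₂ := by omega
  have hEρ : E < ρ := by omega
  have hα : Valued.v (α - 1) = Valued.v ϖ ^ n₂ := hE.2.2.2.2.2.2.1
  have hβ : Valued.v (β - 1) = Valued.v ϖ ^ n₂ := h12 ▸ hE.2.2.2.2.2.1
  have hγ : Valued.v (β - 1 - (α - 1)) = Valued.v ϖ ^ n₂ := by
    rw [show β - 1 - (α - 1) = -(α - β) by ring, Valuation.map_neg, h23]; exact hE.2.2.2.2.2.2.2.1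
  have hα0 : α - 1 ≠ 0 := fun h => by rw [h, map_zero] at hα; exact pow_ne_zero _ hvϖ hα.symm
  set g₀ : K := (β - 1) / (α - 1) with hg₀
  -- the mixed letters, in `g₀`-currency
  have hmix : ∀ ℓ : ℕ, Valued.v (1 * 1 * (β - 1) + (α - 1) * g) ≤ Valued.v ϖ ^ (ℓ + 2 * ρ) ↔ Valued.v (g + g₀) ≤ Valued.v ϖ ^ (ℓ + 2 * ρ - n₂) := by
    intro ℓ
    have hℓ : n₂ ≤ ℓ + 2 * ρ := by omega
    rw [show 1 * 1 * (β - 1) + (α - 1) * g = (g + g₀) * (α - 1) by rw [hg₀]; field_simp; ring,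
      show Valued.v ϖ ^ (ℓ + 2 * ρ) = Valued.v (ϖ ^ (ℓ + 2 * ρ - n₂) * (α - 1)) by rw [map_mul, map_pow, hα, ← pow_add]; congr 1; omega,
      F0P3cDyRamLevelTokenHNF.v_mul_le_mul_iff_of_ne_zero hα0, map_pow]
  have hread : ∀ ℓ : ℕ, LatticeInLevel ϖ ℓ (Matrix.diagonal ![α - 1, β - 1, 0])
      (latt (!![1, 0, 0; 1, ϖ ^ ρ, 0; 1 * 1 + g, ϖ ^ ρ * 1, ϖ ^ (2 * ρ)] : Matrix (Fin 3) (Fin 3) K)) ↔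
      ℓ + ρ ≤ n₂ ∧ Valued.v (g + g₀) ≤ Valued.v ϖ ^ (ℓ + 2 * ρ - n₂) := by
    intro ℓ
    rw [latticeInLevel_diag_latt_H_iff hϖ0 ℓ ρ (α - 1) (β - 1) (x := 1) (ζ := 1) (map_one _) (map_one _) g, hmix ℓ, hα, hβ, hγ]
    simp only [hpw]
    constructor
    · rintro ⟨-, h2, -, h4⟩; exact ⟨by omega, h4⟩
    · rintro ⟨h1, h4⟩; exact ⟨⟨by omega, by omega⟩, by omega, by omega, h4⟩
  constructor
  · rintro ⟨-, hlev, hnlev, -⟩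
    obtain ⟨-, hle⟩ := (hread (d % 2)).1 hlev
    rw [show d % 2 + 2 * ρ - n₂ = E by omega] at hle
    refine (v_eq_pow_iff_le_and_not_le hϖ _ E).2 ⟨hle, fun h => hnlev ((hread (d % 2 + 1)).2 ⟨hρℓ, ?_⟩)⟩
    rwa [show d % 2 + 1 + 2 * ρ - n₂ = E + 1 by omega]
  · intro hcut
    have hle : Valued.v (g + g₀) ≤ Valued.v ϖ ^ E := hcut.le
    refine ⟨hle.trans ((hpw _ _).2 (by omega)), (hread (d % 2)).2 ⟨by omega, by rwa [show d % 2 + 2 * ρ - n₂ = E by omega]⟩, fun h => ?_, ?_⟩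
    · obtain ⟨-, h2⟩ := (hread (d % 2 + 1)).1 h
      rw [show d % 2 + 1 + 2 * ρ - n₂ = E + 1 by omega] at h2
      exact ((v_eq_pow_iff_le_and_not_le hϖ _ E).1 hcut).2 h2
    · -- the square token is automatic on the cut
      rw [latticeInLevel_diag_latt_H_iff hϖ0 (mcOfRecord d) ρ ((α - 1) * (α - 1)) ((β - 1) * (β - 1)) (x := 1) (ζ := 1) (map_one _) (map_one _) g]
      have hA2 : Valued.v ((α - 1) * (α - 1)) = Valued.v ϖ ^ (2 * n₂) := by rw [map_mul, hα, ← pow_add, two_mul]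
      have hB2 : Valued.v ((β - 1) * (β - 1)) = Valued.v ϖ ^ (2 * n₂) := by rw [map_mul, hβ, ← pow_add, two_mul]
      have hAB : Valued.v ((β - 1) * (β - 1) - (α - 1) * (α - 1)) = Valued.v ϖ ^ (2 * n₂) := by
        rw [show (β - 1) * (β - 1) - (α - 1) * (α - 1) = (β - 1 - (α - 1)) * ((β - 1) + (α - 1)) by ring, map_mul, hγ,
          show (β - 1) + (α - 1) = (β - 1 - (α - 1)) + 2 * (α - 1) by ring, Valuation.map_add_eq_of_lt_left _ ?_, hγ, ← pow_add, two_mul]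
        rw [hγ, map_mul, hα, hD.2.2.2.2.2.2]
        calc Valued.v ϖ ^ t * Valued.v ϖ ^ n₂ = Valued.v ϖ ^ (t + n₂) := (pow_add _ _ _).symm
          _ < Valued.v ϖ ^ n₂ := (hpwlt _ _).2 (by
              have ht : t ≠ 0 := fun h0 => by rw [hD.2.2.2.2.2.2, h0, pow_zero] at h2; exact lt_irrefl _ h2
              omega)
      have hsqmix : Valued.v (1 * 1 * ((β - 1) * (β - 1)) + (α - 1) * (α - 1) * g) = Valued.v ϖ ^ (2 * n₂) := by
        have hid : 1 * 1 * ((β - 1) * (β - 1)) + (α - 1) * (α - 1) * g =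
            (β - 1) * (1 * 1 * (β - 1) + (α - 1) * g) + (α - 1) * ((α - 1) - (β - 1)) * g := by ring
        have h2 : Valued.v ((α - 1) * ((α - 1) - (β - 1)) * g) = Valued.v ϖ ^ (2 * n₂) := by
          rw [map_mul, map_mul, hα, hg, mul_one, show (α - 1) - (β - 1) = -(β - 1 - (α - 1)) by ring, Valuation.map_neg, hγ, ← pow_add, two_mul]
        have h1 : Valued.v ((β - 1) * (1 * 1 * (β - 1) + (α - 1) * g)) < Valued.v ((α - 1) * ((α - 1) - (β - 1)) * g) := by
          rw [h2, map_mul, hβ, show 1 * 1 * (β - 1) + (α - 1) * g = (g + g₀) * (α - 1) by rw [hg₀]; field_simp; ring, map_mul, hcut, hα, ← pow_add, ← pow_add,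
            hpwlt]
          omega
        rw [hid, Valuation.map_add_eq_of_lt_right _ h1, h2]
      rw [hsqmix, hA2, hB2, hAB]
      simp only [hpw]
      exact ⟨⟨by omega, by omega⟩, by omega, by omega, by omega⟩

/-- **THE WINDOW CUT, ANY NEARBY CENTRE**: with `|c₀ − (β−1)∕(α−1)| ≤ |ϖ|^{E+1}` (the token ratio `g_β∕g_α`), `(|g + g₀| ≤ |ϖ|^{2ρ−n₂} ∧ clean shell) ⟺ |g + c₀| = |ϖ|^E` for the
core-hanging representative on the equilateral window. [cite: Kottwitz1986BaseChangeUnits, §1 pp. 240–241] [cite: Serre1980Trees, Ch. II §1.1] -/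
theorem glue_and_shell_latt_coreHanging_rep_iff_of_near (hD : IsRamifiedQuadraticDatum σ ϖ d t) (h2 : Valued.v (2 : K) < 1) (h2d : 2 ≤ d) (hE : IsElementDatum σ ϖ N₀ α β n₁ n₂ n₃)
    (ρ : ℕ) (h12 : n₁ = n₂) (h23 : n₂ = n₃) {E : ℕ} (hlo : 2 * ρ + d % 2 = n₂ + E) (hE1 : 1 ≤ E) (hhi : 2 * ρ + mcOfRecord d ≤ 2 * n₂)
    {c₀ : K} (hc₀ : Valued.v (c₀ - (β - 1) / (α - 1)) ≤ Valued.v ϖ ^ (E + 1)) {g : K} (hg : Valued.v g = 1) :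
    (Valued.v (g + (β - 1) / (α - 1)) ≤ Valued.v ϖ ^ (2 * ρ - n₂) ∧
        (LatticeInLevel ϖ (d % 2) (Matrix.diagonal ![α - 1, β - 1, 0]) (latt (!![1, 0, 0; 1, ϖ ^ ρ, 0; 1 * 1 + g, ϖ ^ ρ * 1, ϖ ^ (2 * ρ)] : Matrix (Fin 3) (Fin 3) K)) ∧
          ¬ LatticeInLevel ϖ (d % 2 + 1) (Matrix.diagonal ![α - 1, β - 1, 0]) (latt (!![1, 0, 0; 1, ϖ ^ ρ, 0; 1 * 1 + g, ϖ ^ ρ * 1, ϖ ^ (2 * ρ)] : Matrix (Fin 3) (Fin 3) K)) ∧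
          LatticeInLevel ϖ (mcOfRecord d) (Matrix.diagonal ![(α - 1) * (α - 1), (β - 1) * (β - 1), 0])
            (latt (!![1, 0, 0; 1, ϖ ^ ρ, 0; 1 * 1 + g, ϖ ^ ρ * 1, ϖ ^ (2 * ρ)] : Matrix (Fin 3) (Fin 3) K)))) ↔
      Valued.v (g + c₀) = Valued.v ϖ ^ E := by
  rw [glue_and_shell_latt_coreHanging_rep_iff hD h2 h2d hE ρ h12 h23 hlo hE1 hhi hg, v_add_eq_pow_iff_of_v_sub_le hD.2.2.1 hc₀ g]

/-! ## §2  The orbit sum of the core-hanging representative -/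

variable [CompleteSpace K] [Fintype 𝓀[K]]

open Classical in
/-- **THE UNIT-TORUS ORBIT OF `latt V_H(1,1,g)` CARRIES `mass · ω(D_i)∕(2·#Aβ·#Aγ) · Σ_{aβ,aγ} ω(class_i)·ω(g g_α + aγ T⁻¹ g_β)`** (EQ-2b's HEAD, constant along the orbit by
★ p861389 §3 ∕ ★ StratumTools, summed against ★ B7 (iv)(C) `finsum_stabiliserWeight_orbit_eq`; letters of EQ-2b VERBATIM). [cite: Kottwitz1986BaseChangeUnits, §1 pp. 240–241]
[cite: LanglandsShelstad1987, §3] [cite: Rogawski1990, §4.9 Prop. 4.9.1 (a)(b) p. 55] -/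
theorem finsum_orbit_labelledOdd_div_relIndex_coreHanging_rep_eq (hD : IsRamifiedQuadraticDatum σ ϖ d t) (h2 : Valued.v (2 : K) < 1)
    {ρ : ℕ} (hρ : 1 ≤ ρ) {g : K} (hσg : σ g = g) (hg : Valued.v g = 1) (h1g : Valued.v (1 + g) = 1)
    (V : GL (Fin 3) K) (hV : (V : Matrix (Fin 3) (Fin 3) K) = !![1, 0, 0; 1, ϖ ^ ρ, 0; 1 * 1 + g, ϖ ^ ρ * 1, ϖ ^ (2 * ρ)])
    (hE : IsElementDatum σ ϖ N₀ α β n₁ n₂ n₃) {mc : ℕ} (hℓN : d % 2 + 1 ≤ N₀) (hmN : d % 2 + 2 * d - 1 ≤ N₀)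
    (hℓmc : 2 * (d % 2) + 1 ≤ mc) (hmmc : d % 2 + 2 * d - 1 + d % 2 ≤ mc)
    (hlev : LatticeInLevel ϖ (d % 2) (Matrix.diagonal ![α - 1, β - 1, 0]) (latt (V : Matrix (Fin 3) (Fin 3) K)))
    (hnlev : ¬ LatticeInLevel ϖ (d % 2 + 1) (Matrix.diagonal ![α - 1, β - 1, 0]) (latt (V : Matrix (Fin 3) (Fin 3) K)))
    (hsq : LatticeInLevel ϖ mc (Matrix.diagonal ![(α - 1) * (α - 1), (β - 1) * (β - 1), 0]) (latt (V : Matrix (Fin 3) (Fin 3) K)))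
    {T : GL (Fin 3) K} (hT : (T : Matrix (Fin 3) (Fin 3) K) = Matrix.diagonal ![α, β, 1])
    (hTM : mapGL T (latt (V : Matrix (Fin 3) (Fin 3) K)) = latt (V : Matrix (Fin 3) (Fin 3) K))
    {gα gβ : K} (hσgα : σ gα = gα) (hσgβ : σ gβ = gβ)
    (hgα : Valued.v ((ϖ ^ (d % 2 + 2 * d - 1))⁻¹ * (((ϖ * σ ϖ) ^ ρ)⁻¹ * ((α - 1) - gα * ((ϖ - σ ϖ) * ((ϖ * σ ϖ) ^ ((d - d % 2) / 2))⁻¹)))) ≤ 1)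
    (hgβ : Valued.v ((ϖ ^ (d % 2 + 2 * d - 1))⁻¹ * (((ϖ * σ ϖ) ^ ρ)⁻¹ * ((β - 1) - gβ * ((ϖ - σ ϖ) * ((ϖ * σ ϖ) ^ ((d - d % 2) / 2))⁻¹)))) ≤ 1)
    (Aβ Aγ : Finset K)
    (hAγsub : ∀ a ∈ Aγ, σ a = a ∧ Valued.v (a - 1) ≤ Valued.v ϖ ^ (2 * ρ))
    (hAγ : ∀ p : K, σ p = p → Valued.v (p - 1) ≤ Valued.v ϖ ^ (2 * ρ) →
      ∃! a, a ∈ Aγ ∧ ∃ w : K, Valued.v (w - 1) ≤ Valued.v ϖ ^ (2 * ρ) ∧ w * σ w = a / p)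
    (hAβsub : ∀ a ∈ Aβ, σ a = a ∧ Valued.v (a - 1) ≤ Valued.v ϖ ^ ρ)
    (hAβ : ∀ y : K, σ y = y → Valued.v (y - 1) ≤ Valued.v ϖ ^ ρ →
      ∃! a, a ∈ Aβ ∧ ∃ s : K, Valued.v (s - 1) ≤ Valued.v ϖ ^ (2 * ρ) ∧ s * σ s = a / y)
    (hL : ∀ aβ ∈ Aβ, ∀ aγ ∈ Aγ, g * gα + aγ * (aβ + g⁻¹ * (aβ - 1))⁻¹ * gβ ≠ 0)
    (i : Fin 3) :
    ∑ᶠ M ∈ {M : Submodule 𝒪[K] (Fin 3 → K) | ∃ u ∈ unitTorus K 3,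
        M = mapGL (diagGLUnits u) (latt (!![1, 0, 0; 1, ϖ ^ ρ, 0; 1 * 1 + g, ϖ ^ ρ * 1, ϖ ^ (2 * ρ)] : Matrix (Fin 3) (Fin 3) K))},
        (labelledOddCount σ ϖ 0 i (valueClassLabel σ ϖ (α - 1) (β - 1) (d % 2 + 2 * d - 1) d) M : ℚ) /
          ((((unitStabilizer M).map (unitNormMap σ 3)).relIndex (fixedUnitTorus σ 3) : ℕ) : ℚ) =
      ((((Nat.card 𝓀[K] - 1) * Nat.card 𝓀[K] ^ (ρ - 1)) * ((Nat.card 𝓀[K] - 1) * Nat.card 𝓀[K] ^ (2 * ρ - 1)) : ℕ) : ℚ) *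
        ((((Nat.card 𝓀[K] - 1) * Nat.card 𝓀[K] ^ ((ρ + 1) / 2 - 1)) * ((Nat.card 𝓀[K] - 1) * Nat.card 𝓀[K] ^ (ρ - 1)) : ℕ) : ℚ)⁻¹ *
        ((normSign σ ((![((ϖ * σ ϖ) ^ ρ)⁻¹ * g, ((ϖ * σ ϖ) ^ ρ)⁻¹, -(((ϖ * σ ϖ) ^ ρ)⁻¹ * (1 + g)⁻¹)] : Fin 3 → K) i) : ℚ) / (2 * (Aβ.card : ℚ) * (Aγ.card : ℚ)) *
          ((∑ aβ ∈ Aβ, ∑ aγ ∈ Aγ,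
            normSign σ ((![(1 : K), aγ * (aβ + g⁻¹ * (aβ - 1))⁻¹, aγ * (aβ + g⁻¹ * (aβ - 1))⁻¹ * aβ] : Fin 3 → K) i) *
              normSign σ (g * gα + aγ * (aβ + g⁻¹ * (aβ - 1))⁻¹ * gβ) : ℤ) : ℚ)) := by
  obtain ⟨hσ, hvσ, hϖ, hfix, hd, -, -⟩ := id hD
  have hhead := labelledOddCount_div_relIndex_coreHanging_rep_eq hD h2 hρ hσg hg h1g V hV hE hℓN hmN hℓmc hmmc hlev hnlev hsq hT hTM hσgα hσgβ hgα hgβ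
    Aβ Aγ hAγsub hAγ hAβsub hAβ hL i
  -- the summand is `c · w(M)` along the orbit
  have hconst : ∀ M ∈ {M : Submodule 𝒪[K] (Fin 3 → K) | ∃ u ∈ unitTorus K 3,
        M = mapGL (diagGLUnits u) (latt (!![1, 0, 0; 1, ϖ ^ ρ, 0; 1 * 1 + g, ϖ ^ ρ * 1, ϖ ^ (2 * ρ)] : Matrix (Fin 3) (Fin 3) K))},
      (labelledOddCount σ ϖ 0 i (valueClassLabel σ ϖ (α - 1) (β - 1) (d % 2 + 2 * d - 1) d) M : ℚ) /
          ((((unitStabilizer M).map (unitNormMap σ 3)).relIndex (fixedUnitTorus σ 3) : ℕ) : ℚ) =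
        ((normSign σ ((![((ϖ * σ ϖ) ^ ρ)⁻¹ * g, ((ϖ * σ ϖ) ^ ρ)⁻¹, -(((ϖ * σ ϖ) ^ ρ)⁻¹ * (1 + g)⁻¹)] : Fin 3 → K) i) : ℚ) / (2 * (Aβ.card : ℚ) * (Aγ.card : ℚ)) *
          ((∑ aβ ∈ Aβ, ∑ aγ ∈ Aγ,
            normSign σ ((![(1 : K), aγ * (aβ + g⁻¹ * (aβ - 1))⁻¹, aγ * (aβ + g⁻¹ * (aβ - 1))⁻¹ * aβ] : Fin 3 → K) i) *
              normSign σ (g * gα + aγ * (aβ + g⁻¹ * (aβ - 1))⁻¹ * gβ) : ℤ) : ℚ)) * stabiliserWeight σ M := by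
    rintro M ⟨u, -, rfl⟩
    rw [← hV, labelledOddCount_mapGL_diagGLUnits hσ ϖ 0 i (isTorusEquivariantLabel_valueClassLabel σ ϖ (α - 1) (β - 1) (d % 2 + 2 * d - 1) d),
      unitStabilizer_mapGL_diagGLUnits, stabiliserWeight_mapGL_diagGLUnits, hhead]
    ring
  rw [finsum_mem_congr rfl hconst, ← mul_finsum_mem, finsum_stabiliserWeight_orbit_eq hσ hvσ hfix hϖ hd hρ hσg hg]
  ring

end Summit.HodgeConjecture.HodgeConjecture.Cruxes.H413.F0P3cDyRamLabelledOddCoreHangingWindowCut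

end
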